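import Summits.Ventures.Crystal3D.Theorems.StickyWulffConstantNoReconstructionGainPredSlotBudgetRaisedThreePlanar
import Summits.Ventures.Crystal3D.Theorems.StickyWulffConstantNoReconstructionGainPredSlotBudgetRaisedThreeTangent
import HarnessLib

/-!
# Raised up bond, three contacts: (M1) from betweenness and the cone (pair) step

HONEST FRAMING. Part of the venture `Summits/Ventures/Crystal3D` (cell `crystal3d-full`), helper
`--supports` the crux `NoReconstructionGain` (stmt-Ventures-19144, route
`route-Ventures-StickyWulffConstant`), line `adhesion` (wulff-p1 g15).  Generic real-variable bricks for
regime II (`(b+c)² < 2`) of the last Hall system of B1b₃ (`predSlotBudget_of_upBond_raised_three`,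
skeleton v21), in the tangent-plane language of `…RaisedThreeTangent` (`Q(X,Y) = 2 X·Y − (X·n)(Y·n)`,
`ar(X,Y) = det[X,Y,n]`, frame `|n|² = 2`, contacts `|U|² = 2` of depth `d = U·n`):
* `cramer_pair`, `m1_of_between` — (M1) from betweenness: the Cramer identities packaged for
  `conic_mono`, with a scaled reference point `K` (`|K|² = 2s²`, `K·n = sT₀`, `K·C = s`);
* `conePair_false` — the pair step: two contacts of depth `> T₀ ≥ 1` whose tangent parts lie in a
  wedge `cone(M⊥, Z⊥)` of half-angle `< g₀` (`cos g₀ = (2 − T₀²)/(4 − T₀²)`) have `U·U′ > 1`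
  (factorisation `X²AB − g²P₁P₂ = (AB − g²)(…≥0)` plus `pairGap_mono`);

WHAT THIS IS NOT: the covering template (`…RaisedThreeCover`), the frame-specific inequalities in `(a,b,c)`
and the assembly;
rung F-C1 not moved.
-/

namespace Summit.Ventures.Crystal3D.Theorems

/-- The Cramer identities of the tangent plane (`|n|² = 2`) packaged for `conic_mono`: for generators
`K = (k₁,k₂,k₃)`, `C = (c₁,c₂,c₃)` and a vector `U = (x,y,z)`, with `D = ar(K,C)`, `λ = ar(U,C)`,
`μ = ar(K,U)`:  `D Q(U,C) = λ Q(K,C) + μ Q(C,C)` and `D² Q(U,U) = λ² Q(K,K) + 2λμ Q(K,C) + μ² Q(C,C)`. -/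
theorem cramer_pair {a b c : ℝ} (hn : a ^ 2 + b ^ 2 + c ^ 2 = 2) (k₁ k₂ k₃ c₁ c₂ c₃ x y z : ℝ) :
    (k₁ * (c₂ * c - c₃ * b) - k₂ * (c₁ * c - c₃ * a) + k₃ * (c₁ * b - c₂ * a)) *
      (2 * (x * c₁ + y * c₂ + z * c₃) - (a * x + b * y + c * z) * (a * c₁ + b * c₂ + c * c₃)) =
    (x * (c₂ * c - c₃ * b) - y * (c₁ * c - c₃ * a) + z * (c₁ * b - c₂ * a)) *
      (2 * (k₁ * c₁ + k₂ * c₂ + k₃ * c₃) - (a * k₁ + b * k₂ + c * k₃) * (a * c₁ + b * c₂ + c * c₃)) +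
    (k₁ * (y * c - z * b) - k₂ * (x * c - z * a) + k₃ * (x * b - y * a)) *
      (2 * (c₁ * c₁ + c₂ * c₂ + c₃ * c₃) - (a * c₁ + b * c₂ + c * c₃) * (a * c₁ + b * c₂ + c * c₃)) ∧
    (k₁ * (c₂ * c - c₃ * b) - k₂ * (c₁ * c - c₃ * a) + k₃ * (c₁ * b - c₂ * a)) ^ 2 *
      (2 * (x * x + y * y + z * z) - (a * x + b * y + c * z) * (a * x + b * y + c * z)) =
    (x * (c₂ * c - c₃ * b) - y * (c₁ * c - c₃ * a) + z * (c₁ * b - c₂ * a)) ^ 2 *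
      (2 * (k₁ * k₁ + k₂ * k₂ + k₃ * k₃) - (a * k₁ + b * k₂ + c * k₃) * (a * k₁ + b * k₂ + c * k₃)) +
    2 * (x * (c₂ * c - c₃ * b) - y * (c₁ * c - c₃ * a) + z * (c₁ * b - c₂ * a)) *
      (k₁ * (y * c - z * b) - k₂ * (x * c - z * a) + k₃ * (x * b - y * a)) *
      (2 * (k₁ * c₁ + k₂ * c₂ + k₃ * c₃) - (a * k₁ + b * k₂ + c * k₃) * (a * c₁ + b * c₂ + c * c₃)) +
    (k₁ * (y * c - z * b) - k₂ * (x * c - z * a) + k₃ * (x * b - y * a)) ^ 2 *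
      (2 * (c₁ * c₁ + c₂ * c₂ + c₃ * c₃) - (a * c₁ + b * c₂ + c * c₃) * (a * c₁ + b * c₂ + c * c₃)) := by
  have h1 := tangent_cramer a b c k₁ k₂ k₃ c₁ c₂ c₃ x y z c₁ c₂ c₃
  have h2 := tangent_cramer a b c k₁ k₂ k₃ c₁ c₂ c₃ x y z x y z
  have h3 := tangent_cramer a b c k₁ k₂ k₃ c₁ c₂ c₃ x y z k₁ k₂ k₃
  rw [hn] at h1 h2 h3
  refine ⟨by linear_combination h1, ?_⟩
  -- `D² Q(U,U) = D (λ Q(K,U) + μ Q(C,U)) = λ (D Q(U,K)) + μ (D Q(U,C))`, then Cramer again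
  have hK : (k₁ * (c₂ * c - c₃ * b) - k₂ * (c₁ * c - c₃ * a) + k₃ * (c₁ * b - c₂ * a)) *
      (2 * (x * k₁ + y * k₂ + z * k₃) - (a * x + b * y + c * z) * (a * k₁ + b * k₂ + c * k₃)) =
    (x * (c₂ * c - c₃ * b) - y * (c₁ * c - c₃ * a) + z * (c₁ * b - c₂ * a)) *
      (2 * (k₁ * k₁ + k₂ * k₂ + k₃ * k₃) - (a * k₁ + b * k₂ + c * k₃) * (a * k₁ + b * k₂ + c * k₃)) +
    (k₁ * (y * c - z * b) - k₂ * (x * c - z * a) + k₃ * (x * b - y * a)) *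
      (2 * (c₁ * k₁ + c₂ * k₂ + c₃ * k₃) - (a * c₁ + b * c₂ + c * c₃) * (a * k₁ + b * k₂ + c * k₃)) := by
    linear_combination h3
  linear_combination (x * (c₂ * c - c₃ * b) - y * (c₁ * c - c₃ * a) + z * (c₁ * b - c₂ * a)) * hK +
    (k₁ * (y * c - z * b) - k₂ * (x * c - z * a) + k₃ * (x * b - y * a)) * h1 +
    (k₁ * (c₂ * c - c₃ * b) - k₂ * (c₁ * c - c₃ * a) + k₃ * (c₁ * b - c₂ * a)) * h2

/-- **(M1) from betweenness.**  If the tangent part of the contact `U` lies in the wedge spanned by the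
tangent parts of `K` and `C` with a nonzero `C`-component (`λ D ≥ 0`, `μ D > 0` for the Cramer data
`D = ar(K,C)`, `λ = ar(U,C)`, `μ = ar(K,U)`), where `K` is a (positively scaled, scale `s`) reference
point with `K·C = s`, `K·n = s T₀`, `|K|² = 2 s²` and `2 − T₀ d_C ≥ 0`, then `Q(U,C) > 0` and
`(2 − T₀ d_C)² (4 − d²) < Q(U,C)² (4 − T₀²)`. -/
theorem m1_of_between {a b c x y z k₁ k₂ k₃ c₁ c₂ c₃ d T₀ dC s : ℝ} (hn : a ^ 2 + b ^ 2 + c ^ 2 = 2)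
    (hu : x ^ 2 + y ^ 2 + z ^ 2 = 2) (hd : a * x + b * y + c * z = d) (hC2 : c₁ ^ 2 + c₂ ^ 2 + c₃ ^ 2 = 2)
    (hC : a * c₁ + b * c₂ + c * c₃ = dC) (hs : 0 < s) (hK2 : k₁ ^ 2 + k₂ ^ 2 + k₃ ^ 2 = 2 * s ^ 2)
    (hKn : a * k₁ + b * k₂ + c * k₃ = s * T₀) (hKC : k₁ * c₁ + k₂ * c₂ + k₃ * c₃ = s)
    (hKc : 0 ≤ 2 - T₀ * dC) (hA : 0 < 4 - dC ^ 2)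
    (hdet : (2 - T₀ * dC) ^ 2 < (4 - dC ^ 2) * (4 - T₀ ^ 2))
    (hl : 0 ≤ (x * (c₂ * c - c₃ * b) - y * (c₁ * c - c₃ * a) + z * (c₁ * b - c₂ * a)) *
      (k₁ * (c₂ * c - c₃ * b) - k₂ * (c₁ * c - c₃ * a) + k₃ * (c₁ * b - c₂ * a)))
    (hm : 0 < (k₁ * (y * c - z * b) - k₂ * (x * c - z * a) + k₃ * (x * b - y * a)) *
      (k₁ * (c₂ * c - c₃ * b) - k₂ * (c₁ * c - c₃ * a) + k₃ * (c₁ * b - c₂ * a))) :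
    0 < 2 * (x * c₁ + y * c₂ + z * c₃) - d * dC ∧
      (2 - T₀ * dC) ^ 2 * (4 - d ^ 2) < (2 * (x * c₁ + y * c₂ + z * c₃) - d * dC) ^ 2 * (4 - T₀ ^ 2) := by
  obtain ⟨C1, C2⟩ := cramer_pair hn k₁ k₂ k₃ c₁ c₂ c₃ x y z
  obtain ⟨D, hD⟩ : ∃ s, s = k₁ * (c₂ * c - c₃ * b) - k₂ * (c₁ * c - c₃ * a) + k₃ * (c₁ * b - c₂ * a) := ⟨_, rfl⟩
  obtain ⟨lam, hlam⟩ : ∃ s, s = x * (c₂ * c - c₃ * b) - y * (c₁ * c - c₃ * a) + z * (c₁ * b - c₂ * a) := ⟨_, rfl⟩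
  obtain ⟨mu, hmu⟩ : ∃ s, s = k₁ * (y * c - z * b) - k₂ * (x * c - z * a) + k₃ * (x * b - y * a) := ⟨_, rfl⟩
  rw [← hD] at C1 C2 hl hm
  rw [← hlam] at C1 C2 hl
  rw [← hmu] at C1 C2 hm
  have eKC : 2 * (k₁ * c₁ + k₂ * c₂ + k₃ * c₃) - (a * k₁ + b * k₂ + c * k₃) * (a * c₁ + b * c₂ + c * c₃) =
      s * (2 - T₀ * dC) := by
    rw [hKC, hKn, hC]; ring
  have eCC : 2 * (c₁ * c₁ + c₂ * c₂ + c₃ * c₃) - (a * c₁ + b * c₂ + c * c₃) * (a * c₁ + b * c₂ + c * c₃) = 4 - dC ^ 2 := by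
    rw [hC]; nlinarith only [hC2]
  have eKK : 2 * (k₁ * k₁ + k₂ * k₂ + k₃ * k₃) - (a * k₁ + b * k₂ + c * k₃) * (a * k₁ + b * k₂ + c * k₃) =
      s ^ 2 * (4 - T₀ ^ 2) := by
    rw [hKn]; nlinarith only [hK2]
  have eUU : 2 * (x * x + y * y + z * z) - (a * x + b * y + c * z) * (a * x + b * y + c * z) = 4 - d ^ 2 := by
    rw [hd]; nlinarith only [hu]
  rw [eKC, eCC, hd, hC] at C1
  rw [eKK, eKC, eCC, eUU] at C2
  have hKc' : 0 ≤ s * (2 - T₀ * dC) := mul_nonneg hs.le hKc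
  have hdet' : (s * (2 - T₀ * dC)) ^ 2 < (4 - dC ^ 2) * (s ^ 2 * (4 - T₀ ^ 2)) := by
    have hs2 : 0 < s ^ 2 := by positivity
    nlinarith only [mul_lt_mul_of_pos_left hdet hs2]
  have hDne : D ≠ 0 := by intro h; rw [h] at hm; simp at hm
  have hD2 : 0 < D ^ 2 := by positivity
  -- positivity of `Q(U,C)` straight from Cramer: `D² Q(U,C) = (λD) Q(K,C) + (μD) Q(C,C) > 0`
  have hQ : 0 < 2 * (x * c₁ + y * c₂ + z * c₃) - d * dC := by
    have e : D ^ 2 * (2 * (x * c₁ + y * c₂ + z * c₃) - d * dC) =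
        (lam * D) * (s * (2 - T₀ * dC)) + (mu * D) * (4 - dC ^ 2) := by
      linear_combination D * C1
    have hpos : 0 < D ^ 2 * (2 * (x * c₁ + y * c₂ + z * c₃) - d * dC) := by
      rw [e]; nlinarith only [mul_nonneg hl hKc', mul_pos hm hA]
    by_contra h
    push Not at h
    nlinarith only [hpos, hD2, h, mul_nonpos_iff.2 (Or.inl ⟨hD2.le, h⟩)]
  refine ⟨hQ, ?_⟩
  have hs2 : 0 < s ^ 2 := by positivity
  suffices H : (s * (2 - T₀ * dC)) ^ 2 * (4 - d ^ 2) <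
      (2 * (x * c₁ + y * c₂ + z * c₃) - d * dC) ^ 2 * (s ^ 2 * (4 - T₀ ^ 2)) by
    by_contra h
    push Not at h
    nlinarith only [H, mul_le_mul_of_nonneg_left h hs2.le]
  rcases lt_or_gt_of_ne hDne with hDneg | hDpos
  · -- `D < 0`: use `(-D, -λ, -μ)`
    have hl' : 0 ≤ -lam := by
      by_contra h
      push Not at h
      nlinarith only [hl, mul_pos (by linarith : 0 < lam) (neg_pos.2 hDneg)]
    have hm' : 0 < -mu := by
      by_contra h
      push Not at h
      nlinarith only [hm, mul_nonneg (by linarith : 0 ≤ mu) (neg_pos.2 hDneg).le]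
    obtain ⟨-, -, h2⟩ := conic_mono (D := -D) (lam := -lam) (mu := -mu) (A := 4 - dC ^ 2)
      (Kc := s * (2 - T₀ * dC)) (KK := s ^ 2 * (4 - T₀ ^ 2)) (QUC := 2 * (x * c₁ + y * c₂ + z * c₃) - d * dC)
      (QUU := 4 - d ^ 2) hl' hm'.le hA hKc' (by linarith) hdet'.le (by linear_combination (-1 : ℝ) * C1)
      (by linear_combination C2)
    exact h2 hm' hdet'
  · have hl' : 0 ≤ lam := by
      by_contra h
      push Not at h
      nlinarith only [hl, mul_pos (by linarith : 0 < -lam) hDpos]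
    have hm' : 0 < mu := by
      by_contra h
      push Not at h
      nlinarith only [hm, mul_nonneg (by linarith : 0 ≤ -mu) hDpos.le]
    obtain ⟨-, -, h2⟩ := conic_mono (D := D) (lam := lam) (mu := mu) (A := 4 - dC ^ 2)
      (Kc := s * (2 - T₀ * dC)) (KK := s ^ 2 * (4 - T₀ ^ 2)) (QUC := 2 * (x * c₁ + y * c₂ + z * c₃) - d * dC)
      (QUU := 4 - d ^ 2) hl' hm'.le hA hKc' hDpos hdet'.le (by linear_combination C1) (by linear_combination C2)
    exact h2 hm' hdet'

/-- **Same-side pair exclusion (cone step).**  Frame `n = (a,b,c)` (`|n|² = 2`), two vectors `M = (p,q,r)`,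
`Z = (e,f,g)` whose tangent parts span a proper wedge (`ar(M,Z) ≠ 0`, `Q(M,Z) > 0`) of half-angle
smaller than `g₀` (`hkey`: `cos² ∠(M⊥,Z⊥) > cos² g₀ = (2 − T₀²)²/(4 − T₀²)²`), and two contacts `U₁, U₂`
(`|Uᵢ|² = 2`, depths `dᵢ > T₀ ≥ 1`, `U₁·U₂ ≤ 1`) whose tangent parts both lie in the wedge (`hlᵢ`, `hmᵢ`:
conic coordinates of the sign of `ar(M,Z)`).  Contradiction: the wedge forces
`cos ∠(U₁⊥,U₂⊥) ≥ cos ∠(M⊥,Z⊥) > cos g₀`, while `U₁·U₂ ≤ 1` and `pairGap_mono` force `≤ cos g₀`. -/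
theorem conePair_false {a b c p q r e f g x₁ y₁ z₁ x₂ y₂ z₂ T₀ d₁ d₂ : ℝ}
    (hn : a ^ 2 + b ^ 2 + c ^ 2 = 2) (hu₁ : x₁ ^ 2 + y₁ ^ 2 + z₁ ^ 2 = 2) (hu₂ : x₂ ^ 2 + y₂ ^ 2 + z₂ ^ 2 = 2)
    (hd₁ : a * x₁ + b * y₁ + c * z₁ = d₁) (hd₂ : a * x₂ + b * y₂ + c * z₂ = d₂)
    (hT1 : 1 ≤ T₀) (hdT₁ : T₀ < d₁) (hdT₂ : T₀ < d₂) (h12 : x₁ * x₂ + y₁ * y₂ + z₁ * z₂ ≤ 1)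
    (hG : 0 < (2 * (p * e + q * f + r * g) - (a * p + b * q + c * r) * (a * e + b * f + c * g)))
    (hkey : (2 - T₀ ^ 2) ^ 2 * ((2 * (p * p + q * q + r * r) - (a * p + b * q + c * r) * (a * p + b * q + c * r)) * (2 * (e * e + f * f + g * g) - (a * e + b * f + c * g) * (a * e + b * f + c * g))) < (2 * (p * e + q * f + r * g) - (a * p + b * q + c * r) * (a * e + b * f + c * g)) ^ 2 * (4 - T₀ ^ 2) ^ 2)
    (hD : (p * (f * c - g * b) - q * (e * c - g * a) + r * (e * b - f * a)) ≠ 0)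
    (hl₁ : 0 ≤ (x₁ * (f * c - g * b) - y₁ * (e * c - g * a) + z₁ * (e * b - f * a)) * (p * (f * c - g * b) - q * (e * c - g * a) + r * (e * b - f * a)))
    (hm₁ : 0 ≤ (p * (y₁ * c - z₁ * b) - q * (x₁ * c - z₁ * a) + r * (x₁ * b - y₁ * a)) * (p * (f * c - g * b) - q * (e * c - g * a) + r * (e * b - f * a)))
    (hl₂ : 0 ≤ (x₂ * (f * c - g * b) - y₂ * (e * c - g * a) + z₂ * (e * b - f * a)) * (p * (f * c - g * b) - q * (e * c - g * a) + r * (e * b - f * a)))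
    (hm₂ : 0 ≤ (p * (y₂ * c - z₂ * b) - q * (x₂ * c - z₂ * a) + r * (x₂ * b - y₂ * a)) * (p * (f * c - g * b) - q * (e * c - g * a) + r * (e * b - f * a))) : False := by
  obtain ⟨C11, C21⟩ := cramer_pair hn p q r e f g x₁ y₁ z₁
  obtain ⟨C12, C22⟩ := cramer_pair hn p q r e f g x₂ y₂ z₂
  have X12 := tangent_cramer a b c p q r e f g x₁ y₁ z₁ x₂ y₂ z₂
  have XM2 := tangent_cramer a b c p q r e f g x₂ y₂ z₂ p q r
  rw [hn] at X12 XM2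
  obtain ⟨D, hDdef⟩ : ∃ s, s = (p * (f * c - g * b) - q * (e * c - g * a) + r * (e * b - f * a)) := ⟨_, rfl⟩
  obtain ⟨l₁, hl₁def⟩ : ∃ s, s = (x₁ * (f * c - g * b) - y₁ * (e * c - g * a) + z₁ * (e * b - f * a)) := ⟨_, rfl⟩
  obtain ⟨m₁, hm₁def⟩ : ∃ s, s = (p * (y₁ * c - z₁ * b) - q * (x₁ * c - z₁ * a) + r * (x₁ * b - y₁ * a)) := ⟨_, rfl⟩
  obtain ⟨l₂, hl₂def⟩ : ∃ s, s = (x₂ * (f * c - g * b) - y₂ * (e * c - g * a) + z₂ * (e * b - f * a)) := ⟨_, rfl⟩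
  obtain ⟨m₂, hm₂def⟩ : ∃ s, s = (p * (y₂ * c - z₂ * b) - q * (x₂ * c - z₂ * a) + r * (x₂ * b - y₂ * a)) := ⟨_, rfl⟩
  obtain ⟨A, hAdef⟩ : ∃ s, s = (2 * (p * p + q * q + r * r) - (a * p + b * q + c * r) * (a * p + b * q + c * r)) := ⟨_, rfl⟩
  obtain ⟨B, hBdef⟩ : ∃ s, s = (2 * (e * e + f * f + g * g) - (a * e + b * f + c * g) * (a * e + b * f + c * g)) := ⟨_, rfl⟩
  obtain ⟨G, hGdef⟩ : ∃ s, s = (2 * (p * e + q * f + r * g) - (a * p + b * q + c * r) * (a * e + b * f + c * g)) := ⟨_, rfl⟩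
  rw [← hDdef] at C11 C21 C12 C22 X12 XM2 hD hl₁ hm₁ hl₂ hm₂
  rw [← hl₁def] at C11 C21 X12 hl₁
  rw [← hm₁def] at C11 C21 X12 hm₁
  rw [← hl₂def] at C12 C22 XM2 hl₂
  rw [← hm₂def] at C12 C22 XM2 hm₂
  rw [← hAdef] at C21 C22 XM2 hkey
  rw [← hBdef] at C11 C21 C12 C22 hkey
  rw [← hGdef] at C11 C21 C12 C22 hkey hG
  -- the quantities of the two contacts
  have eP₁ : 2 * (x₁ * x₁ + y₁ * y₁ + z₁ * z₁) - (a * x₁ + b * y₁ + c * z₁) * (a * x₁ + b * y₁ + c * z₁) = 4 - d₁ ^ 2 := by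
    rw [hd₁]; nlinarith only [hu₁]
  have eP₂ : 2 * (x₂ * x₂ + y₂ * y₂ + z₂ * z₂) - (a * x₂ + b * y₂ + c * z₂) * (a * x₂ + b * y₂ + c * z₂) = 4 - d₂ ^ 2 := by
    rw [hd₂]; nlinarith only [hu₂]
  rw [eP₁] at C21
  rw [eP₂] at C22
  -- `D² Q(U₁,U₂) = λ₁ (λ₂ A + μ₂ G) + μ₁ (λ₂ G + μ₂ B)`
  have eZ2 : D * (2 * (e * x₂ + f * y₂ + g * z₂) - (a * e + b * f + c * g) * (a * x₂ + b * y₂ + c * z₂)) = l₂ * G + m₂ * B := by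
    linear_combination C12
  have eM2 : D * (2 * (p * x₂ + q * y₂ + r * z₂) - (a * p + b * q + c * r) * (a * x₂ + b * y₂ + c * z₂)) = l₂ * A + m₂ * G := by
    linear_combination XM2 - m₂ * hGdef
  have X : D ^ 2 * (2 * (x₁ * x₂ + y₁ * y₂ + z₁ * z₂) - d₁ * d₂) = l₁ * (l₂ * A + m₂ * G) + m₁ * (l₂ * G + m₂ * B) := by
    rw [← hd₁, ← hd₂]; linear_combination D * X12 + l₁ * eM2 + m₁ * eZ2
  -- signs
  have hD2 : 0 < D ^ 2 := by positivity
  have hll : 0 ≤ l₁ * l₂ := by nlinarith only [mul_nonneg hl₁ hl₂, hD2]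
  have hmm : 0 ≤ m₁ * m₂ := by nlinarith only [mul_nonneg hm₁ hm₂, hD2]
  have hlm : 0 ≤ l₁ * m₂ + l₂ * m₁ := by nlinarith only [mul_nonneg hl₁ hm₂, mul_nonneg hl₂ hm₁, hD2]
  have hlm₁ : 0 ≤ l₁ * m₁ := by nlinarith only [mul_nonneg hl₁ hm₁, hD2]
  have hlm₂ : 0 ≤ l₂ * m₂ := by nlinarith only [mul_nonneg hl₂ hm₂, hD2]
  have hA : 0 ≤ A := by
    rw [hAdef]; nlinarith only [sq_nonneg (a * q - b * p), sq_nonneg (a * r - c * p), sq_nonneg (b * r - c * q), hn]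
  have hB : 0 ≤ B := by
    rw [hBdef]; nlinarith only [sq_nonneg (a * f - b * e), sq_nonneg (a * g - c * e), sq_nonneg (b * g - c * f), hn]
  have hAB : G ^ 2 ≤ A * B := by
    have h := tangent_gram a b c p q r e f g
    rw [hn, ← hAdef, ← hBdef, ← hGdef, ← hDdef] at h
    nlinarith only [h, sq_nonneg D]
  -- depths
  have hd₁2 : d₁ < 2 ∨ d₁ = 2 := by
    refine (lt_or_eq_of_le ?_)
    nlinarith only [sq_nonneg (a - x₁), sq_nonneg (b - y₁), sq_nonneg (c - z₁), hn, hu₁, hd₁]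
  have hP₁ : 0 ≤ 4 - d₁ ^ 2 := by nlinarith only [C21, hA, hB, hG, hlm₁, sq_nonneg l₁, sq_nonneg m₁, hD2, mul_nonneg (mul_nonneg hA (sq_nonneg l₁)) hD2.le]
  have hP₂ : 0 ≤ 4 - d₂ ^ 2 := by nlinarith only [C22, hA, hB, hG, hlm₂, sq_nonneg l₂, sq_nonneg m₂, hD2, mul_nonneg (mul_nonneg hA (sq_nonneg l₂)) hD2.le]
  obtain ⟨Q, hQ⟩ : ∃ s, s = 2 * (x₁ * x₂ + y₁ * y₂ + z₁ * z₂) - d₁ * d₂ := ⟨_, rfl⟩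
  rw [← hQ] at X
  -- `Q ≥ 0`
  have hQ0 : 0 ≤ Q := by
    have h : 0 ≤ D ^ 2 * Q := by
      rw [X]
      have e : l₁ * (l₂ * A + m₂ * G) + m₁ * (l₂ * G + m₂ * B) = (l₁ * l₂) * A + (l₁ * m₂ + l₂ * m₁) * G + (m₁ * m₂) * B := by ring
      rw [e]; nlinarith only [mul_nonneg hll hA, mul_nonneg hlm hG.le, mul_nonneg hmm hB]
    by_contra h'
    push Not at h'
    nlinarith only [h, h', hD2]
  -- the cone inequality `Q² A B ≥ G² (4 - d₁²)(4 - d₂²)` via the factorisation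
  have cone : G ^ 2 * ((4 - d₁ ^ 2) * (4 - d₂ ^ 2)) ≤ Q ^ 2 * (A * B) := by
    have iden : (D ^ 2 * Q) ^ 2 * (A * B) - G ^ 2 * ((D ^ 2 * (4 - d₁ ^ 2)) * (D ^ 2 * (4 - d₂ ^ 2))) =
        (A * B - G ^ 2) * ((l₁ * l₂ * A + m₁ * m₂ * B) ^ 2 +
          2 * G * (l₂ * m₂ * (l₁ ^ 2 * A + m₁ ^ 2 * B) + l₁ * m₁ * (l₂ ^ 2 * A + m₂ ^ 2 * B)) +
          4 * (l₁ * m₁) * (l₂ * m₂) * G ^ 2) := by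
      rw [X, C21, C22]; ring
    have hq : 0 ≤ (l₁ * l₂ * A + m₁ * m₂ * B) ^ 2 +
          2 * G * (l₂ * m₂ * (l₁ ^ 2 * A + m₁ ^ 2 * B) + l₁ * m₁ * (l₂ ^ 2 * A + m₂ ^ 2 * B)) +
          4 * (l₁ * m₁) * (l₂ * m₂) * G ^ 2 := by
      have h1 : 0 ≤ l₁ ^ 2 * A + m₁ ^ 2 * B := by nlinarith only [hA, hB, sq_nonneg l₁, sq_nonneg m₁]
      have h2 : 0 ≤ l₂ ^ 2 * A + m₂ ^ 2 * B := by nlinarith only [hA, hB, sq_nonneg l₂, sq_nonneg m₂]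
      nlinarith only [sq_nonneg (l₁ * l₂ * A + m₁ * m₂ * B), mul_nonneg hG.le (mul_nonneg hlm₂ h1),
        mul_nonneg hG.le (mul_nonneg hlm₁ h2), mul_nonneg (mul_nonneg hlm₁ hlm₂) (sq_nonneg G)]
    have h4 : 0 < D ^ 2 * D ^ 2 := by positivity
    have key : 0 ≤ (D ^ 2 * D ^ 2) * (Q ^ 2 * (A * B) - G ^ 2 * ((4 - d₁ ^ 2) * (4 - d₂ ^ 2))) := by
      have e : (D ^ 2 * D ^ 2) * (Q ^ 2 * (A * B) - G ^ 2 * ((4 - d₁ ^ 2) * (4 - d₂ ^ 2))) =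
          (D ^ 2 * Q) ^ 2 * (A * B) - G ^ 2 * ((D ^ 2 * (4 - d₁ ^ 2)) * (D ^ 2 * (4 - d₂ ^ 2))) := by ring
      rw [e, iden]; exact mul_nonneg (by linarith) hq
    by_contra h'
    push Not at h'
    nlinarith only [key, h', h4]
  -- contact side: `Q ≤ 2 - d₁ d₂`, and `pairGap_mono`
  have hQle : Q ≤ 2 - d₁ * d₂ := by rw [hQ]; linarith
  have hde : d₁ * d₂ ≤ 2 := by linarith
  have hd2' : d₁ < 2 := by
    rcases hd₁2 with h | h
    · exact h
    · exfalso; nlinarith only [h, hde, hdT₁, hdT₂, hT1]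
  have hT2 : T₀ < 2 := by linarith
  have gap := pairGap_mono hT1 hT2 hdT₁.le hdT₂.le hde
  -- combine: `(4-T₀²)² Q² A B ≥ (4-T₀²)² G² P₁P₂`, `G²(4-T₀²)² P₁P₂ > (2-T₀²)² A B P₁P₂ ≥ A B (4-T₀²)² (2-d₁d₂)² ≥ A B (4-T₀²)² Q²`
  have hP12 : 0 < (4 - d₁ ^ 2) * (4 - d₂ ^ 2) := by
    have h1 : 0 < 4 - d₁ ^ 2 := by nlinarith only [hd2', hdT₁, hT1]
    have h2 : 0 < 4 - d₂ ^ 2 := by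
      have : d₂ < 2 := by
        by_contra h; push Not at h; nlinarith only [h, hde, hdT₁, hdT₂, hT1]
      nlinarith only [this, hdT₂, hT1]
    positivity
  have hQ2 : Q ^ 2 ≤ (2 - d₁ * d₂) ^ 2 := by nlinarith only [hQ0, hQle]
  have hABn : 0 ≤ A * B := mul_nonneg hA hB
  nlinarith only [cone, gap, hkey, hQ2, hP12, hABn, mul_lt_mul_of_pos_right hkey hP12,
    mul_le_mul_of_nonneg_left gap hABn, mul_le_mul_of_nonneg_left hQ2 (mul_nonneg hABn (sq_nonneg (4 - T₀ ^ 2))),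
    mul_le_mul_of_nonneg_left cone (sq_nonneg (4 - T₀ ^ 2))]

end Summit.Ventures.Crystal3D.Theorems
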